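import Mathlib

/-!
# Tier3GaussSumPair — the split-pair root-number identity `ε(½, ω, ψ) ε(½, ω⁻¹, ψ) = ω(−1)`
at every conductor exponent, on `ℤ/N` (cell pub-hodge-repro, seat t3-p2 g5; Mathlib only)

The cell's step (S2) of T3-P2-NOTE-g4-FINDING2 §2 (the local input at a SPLIT place `v = 𝔭𝔭̄`
of `F` in the root-number comparison `W(χ₀*) = W(χ_j′*)`, and the local input at `v ∣ p` of the
β-step «(cf. [Hsi12, Prop. 6.7])» of Hsieh 2014's key lemma — T3-P2-NOTE-g5-HSI12 §2 (a)) is the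
identity, for a character `ω` of `F_v^×` of conductor exponent `a ≥ 1`,
`ε(½, ω, ψ) · ε(½, ω⁻¹, ψ) = ω(−1)`, derived in the cell from Kudla's printed Gauss-sum formula
(«Tate's thesis», Prop 3.8(ii), book:editornd-introduction-langlands-program p0109:L3–L9):
`ε(½, ω, ψ) = ω(ϖ^{a}) 𝔤(ω, ψ)` with `𝔤(ω, ψ) = q^{a/2} ∫_{𝒪^×} ω⁻¹(y) ψ(ϖ^{−a} y) dy`
(`ν(ψ) = 0`). Murase–Sugano, Compositio Math. 123 (2000) 273–302, print (3.9) p. 281 state the same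
identity «It is known that … e(ω, ψ_K) e(ω⁻¹, ψ_K) = ω(−1)».

In the cell's situation `deg 𝔭 = 1`, so `F_v = ℚ_p`, `𝒪 = ℤ_p`, `ϖ = p`, and the integrand of `𝔤`
factors through `(ℤ/p^a)^×`: with `e(y) := ψ(p^{−a} y)` — a PRIMITIVE additive character of `ℤ/p^a`
when `ψ` has conductor `0` — and the Haar measure of a coset of `1 + p^a ℤ_p` equal to `p^{−a}`,
`𝔤(ω, ψ) = p^{a/2} · p^{−a} · ∑_{y ∈ (ℤ/p^a)^×} ω⁻¹(y) e(y) = p^{−a/2} · g(ω⁻¹, e)`,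
where `g(χ, e) = ∑_y χ(y) e(y)` is Mathlib's `gaussSum` of the Dirichlet character `χ := ω⁻¹`
modulo `N = p^a` (primitive exactly when the conductor exponent is `a`). Hence (S2) at conductor
exponent `a` IS the statement `g(χ, e) · g(χ⁻¹, e) = χ(−1) · N` proved here
(`gaussSum_mul_gaussSum_inv_eq_of_isPrimitive`): `𝔤(ω, ψ) 𝔤(ω⁻¹, ψ) = p^{−a} · χ(−1) · p^a = ω(−1)`.
The normalised form (`normalized_gaussSum_mul_normalized_gaussSum_inv`) is the identity with
Kudla's `q^{a/2}` written in. The tame case (conductor exponent `1`, a finite field) is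
`gaussSum_mul_gaussSum_inv_eq_card_mul` (from Mathlib's `gaussSum_mul_gaussSum_eq_card`).

The last two theorems are the «`χ*_v(2ϑ)`» side of Hsieh's split-place dichotomy (Hsieh 2012,
Lemma 6.6(2) = Murase–Sugano Prop 3.7(ii) p. 281): on `K_v = F_v × F_v` the self-dual character is
the pair `(ω, ω⁻¹)`, and `2ϑ ↦ (u, −u)` with `u` a unit, so `χ*_v(2ϑ) = ω(u) ω⁻¹(−u) = ω(−1)`,
the same sign `±1` as the product of the two root numbers: `map_mul_inv_map_neg` and
`map_neg_one_mul_self`.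

No definition of the cell's objects is made; everything is stated for an arbitrary modulus `N`,
an arbitrary domain `R` as target (a field where inverses of values are taken).
-/

namespace HodgeRepro.T3.GaussSumPair

open AddChar DirichletCharacter Finset

section Primitive

variable {N : ℕ} [NeZero N] {R : Type*} [CommRing R] [IsDomain R]

/-- The product formula for the Gauss sums of a PRIMITIVE Dirichlet character `χ` modulo `N` and
of its inverse, both against the same primitive additive character `e` of `ℤ/N`:
`g(χ, e) · g(χ⁻¹, e) = χ(−1) · N`. This is the split-pair identity (S2)
`ε(½, ω, ψ) ε(½, ω⁻¹, ψ) = ω(−1)` at conductor exponent `a` with `N = p^a` (module docstring). -/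
theorem gaussSum_mul_gaussSum_inv_eq_of_isPrimitive {χ : DirichletCharacter R N}
    (hχ : χ.IsPrimitive) {e : AddChar (ZMod N) R} (he : e.IsPrimitive) :
    gaussSum χ e * gaussSum χ⁻¹ e = χ (-1) * N := by
  have h1 : ∀ b : ZMod N, χ⁻¹ b * gaussSum χ e = gaussSum χ (e.mulShift b) := fun b =>
    (gaussSum_mulShift_of_isPrimitive e hχ b).symm
  have step1 : gaussSum χ e * gaussSum χ⁻¹ e = ∑ b, gaussSum χ (e.mulShift b) * e b := by
    rw [show gaussSum χ⁻¹ e = ∑ b, χ⁻¹ b * e b from rfl, mul_sum]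
    refine sum_congr rfl fun b _ => ?_
    rw [← h1 b]
    ring
  have step2 : ∀ b : ZMod N, gaussSum χ (e.mulShift b) * e b = ∑ a, χ a * e (b * (a + 1)) := by
    intro b
    rw [gaussSum, sum_mul]
    refine sum_congr rfl fun a _ => ?_
    rw [mulShift_apply, mul_assoc, ← map_add_eq_mul, mul_add, mul_one]
  have step4 : ∀ a : ZMod N,
      ∑ b : ZMod N, e (b * (a + 1)) = ((if a + 1 = 0 then Fintype.card (ZMod N) else 0 : ℕ) : R) :=
    fun a => sum_mulShift (a + 1) he
  rw [step1, sum_congr rfl fun b _ => step2 b, sum_comm]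
  simp only [← mul_sum, step4, Nat.cast_ite, Nat.cast_zero, mul_ite, mul_zero,
    add_eq_zero_iff_eq_neg]
  rw [sum_ite_eq' univ (-1 : ZMod N)]
  simp only [mem_univ, if_true, ZMod.card]

/-- The normalised form (Kudla's `𝔤 = q^{a/2} ∫ …`): if `s` is a square root of `N` in a field
`R`, then `(g(χ, e)/s) · (g(χ⁻¹, e)/s) = χ(−1)` — the two root numbers `ε(½, ω, ψ)`, `ε(½, ω⁻¹, ψ)`
(unit multiples of the normalised Gauss sums) multiply to `ω(−1)`. -/
theorem normalized_gaussSum_mul_normalized_gaussSum_inv {K : Type*} [Field K]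
    {χ : DirichletCharacter K N} (hχ : χ.IsPrimitive) {e : AddChar (ZMod N) K}
    (he : e.IsPrimitive) {s : K} (hs : s * s = N) (hs0 : s ≠ 0) :
    (gaussSum χ e / s) * (gaussSum χ⁻¹ e / s) = χ (-1) := by
  have hN : (N : K) ≠ 0 := by
    rw [← hs]
    exact mul_ne_zero hs0 hs0
  rw [div_mul_div_comm, gaussSum_mul_gaussSum_inv_eq_of_isPrimitive hχ he, hs,
    mul_div_assoc, div_self hN, mul_one]

end Primitive

section Tame

variable {F : Type*} [Field F] [Fintype F] {R : Type*} [CommRing R] [IsDomain R]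

/-- The tame case (conductor exponent `1`, `𝒪/ϖ = F` a finite field): for a nontrivial
multiplicative character `χ` of `F` and a primitive additive character `ψ`,
`g(χ, ψ) · g(χ⁻¹, ψ) = χ(−1) · #F` (Mathlib's `gaussSum_mul_gaussSum_eq_card` has `ψ⁻¹` in the
second factor; `mul_gaussSum_inv_eq_gaussSum` converts). -/
theorem gaussSum_mul_gaussSum_inv_eq_card_mul {χ : MulChar F R} (hχ : χ ≠ 1)
    {ψ : AddChar F R} (hψ : ψ.IsPrimitive) :
    gaussSum χ ψ * gaussSum χ⁻¹ ψ = χ (-1) * Fintype.card F := by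
  rw [← mul_gaussSum_inv_eq_gaussSum χ⁻¹, mul_left_comm, gaussSum_mul_gaussSum_eq_card hχ hψ,
    MulChar.inv_apply', inv_neg_one]

end Tame

section Sign

variable {A : Type*} [CommRing A] {K : Type*} [Field K]

/-- `χ(−1)` is its own inverse: `χ(−1) · χ(−1) = χ(1) = 1` — the root-number product is a sign. -/
theorem map_neg_one_mul_self (χ : MulChar A K) : χ (-1) * χ (-1) = 1 := by
  rw [← map_mul, neg_one_mul, neg_neg, map_one]

/-- `χ(−1)⁻¹ = χ(−1)`. -/
theorem map_neg_one_inv (χ : MulChar A K) : (χ (-1))⁻¹ = χ (-1) :=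
  inv_eq_of_mul_eq_one_right (map_neg_one_mul_self χ)

/-- The value of the self-dual pair `(χ, χ⁻¹)` on `K_v = F_v × F_v` at an element `(u, −u)` with
`u` a unit — Hsieh's `χ*_v(2ϑ)` for `ϑ̄ = −ϑ` — is `χ(−1)`: `χ(u) · χ⁻¹(−u) = χ(−1)`. Together with
`gaussSum_mul_gaussSum_inv_eq_of_isPrimitive` this is the split-place dichotomy
`W(χ*_v) = χ*_v(2ϑ)` (Hsieh 2012 Lemma 6.6(2) = Murase–Sugano Prop 3.7(ii)), with no hypothesis on
the conductor of `χ`. -/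
theorem map_mul_inv_map_neg (χ : MulChar A K) (u : Aˣ) :
    χ u * χ⁻¹ (-(u : A)) = χ (-1) := by
  have hu : χ (u : A) ≠ 0 := by
    rw [← χ.coe_toUnitHom]
    exact Units.ne_zero _
  rw [MulChar.inv_apply_eq_inv', show (-(u : A)) = (-1) * (u : A) by ring, map_mul, mul_inv,
    mul_comm, mul_assoc, inv_mul_cancel₀ hu, mul_one, map_neg_one_inv]

end Sign

end HodgeRepro.T3.GaussSumPair

/-!
## Appendix (v2): the self-dual pair on a split place, as group-hom bookkeeping

On `K_v = F_v × F_v` a character `ω` of `K_v^× = F_v^× × F_v^×` that is trivial on the diagonal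
`F_v^×` (the split case of «`ω|_{F^×} = ω_{K/F}`», Murase–Sugano Prop 3.7(ii) / Hsieh 2012
Lemma 6.6(2): `τ_{K/F,v} = 1` at a split `v`) is the pair `(ω₁, ω₁⁻¹)` with `ω₁ := ω(·, 1)`, and its
value at `(u, −u)` (Hsieh's `2ϑ`, `ϑ̄ = −ϑ`) is `ω₁(−1)`. Stated for an arbitrary commutative
group `G` (`= F_v^×`) and an arbitrary commutative group `H` of values.
-/

namespace HodgeRepro.T3.GaussSumPair

section SplitPair

variable {G : Type*} [CommGroup G] {H : Type*} [CommGroup H]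

/-- A character of `G × G` trivial on the diagonal is `(x, y) ↦ ω(x, 1) · ω(y, 1)⁻¹`. -/
theorem apply_eq_mul_inv_of_diag (ω : G × G →* H) (hω : ∀ x : G, ω (x, x) = 1) (x y : G) :
    ω (x, y) = ω (x, 1) * (ω (y, 1))⁻¹ := by
  have h1 : ω (x, y) = ω (x, 1) * ω (1, y) := by
    rw [← map_mul, Prod.mk_mul_mk, mul_one, one_mul]
  have h2 : ω (1, y) * ω (y, 1) = 1 := by
    rw [← map_mul, Prod.mk_mul_mk, one_mul, mul_one, hω]
  rw [h1, eq_inv_of_mul_eq_one_left h2]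

/-- The value of such a character at `(u, c · u)` is `ω(c, 1)⁻¹`; with `c = −1` this is the
«`χ*_v(2ϑ) = ω₁(−1)`» line of the split-place dichotomy (`ω₁(−1)⁻¹ = ω₁(−1)`). -/
theorem apply_mul_of_diag (ω : G × G →* H) (hω : ∀ x : G, ω (x, x) = 1) (u c : G) :
    ω (u, c * u) = (ω (c, 1))⁻¹ := by
  have hc : ω (c * u, 1) = ω (c, 1) * ω (u, 1) := by
    rw [← map_mul, Prod.mk_mul_mk, mul_one]
  rw [apply_eq_mul_inv_of_diag ω hω, hc, mul_inv, mul_comm (ω (u, 1)), mul_assoc, inv_mul_cancel,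
    mul_one]

end SplitPair

section SplitPairRing

variable {A : Type*} [CommRing A] {H : Type*} [CommGroup H]

/-- On `Aˣ × Aˣ` (`A = F_v`), a character trivial on the diagonal takes the value `ω(−1, 1)`
at `(u, −u)`: the «`χ*_v(2ϑ) = ω₁(−1)`» line of the split-place dichotomy, for every unit `u`. -/
theorem apply_neg_of_diag (ω : Aˣ × Aˣ →* H) (hω : ∀ x : Aˣ, ω (x, x) = 1) (u : Aˣ) :
    ω (u, -u) = ω (-1, 1) := by
  rw [← neg_one_mul u, apply_mul_of_diag ω hω, ← map_inv, Prod.inv_mk, inv_neg_one, inv_one]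

end SplitPairRing

end HodgeRepro.T3.GaussSumPair

/-!
## Appendix (v3): the Gauss sum of a primitive character does not vanish

The modified Euler factor of Hsieh 2014 at a place `w ∣ p` where the branch twist is ramified,
`Eul(χ_w) = χ_w(2ϑ_w) · ε(0, χ_w, ψ)⁻¹` ((E:modifiedEuler.V), Main_Body.tex L407–L409; Kudla Prop
3.8(ii) `ε = ω(ϖ^{ν+c}) q^{(½−s)(ν+c)} 𝔤(ω, ψ)`), is a NON-ZERO algebraic number, not a p-adic unit
(t3-p3 R2-PINNING-ADDENDUM-4 §A20 (4), precision P1′). Its non-vanishing is the non-vanishing of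
the Gauss sum of the primitive character `χ_w|_{𝒪^×}` modulo `p^n` — here, from the product
formula of v1: `g(χ, e) · g(χ⁻¹, e) = χ(−1) · N ≠ 0`.
-/

namespace HodgeRepro.T3.GaussSumPair

section NonVanishing

variable {N : ℕ} [NeZero N] {R : Type*} [CommRing R] [IsDomain R]

/-- `χ(−1) · χ(−1) = 1` for any multiplicative character into a commutative ring. -/
theorem map_neg_one_mul_self' {A : Type*} [CommRing A] {B : Type*} [CommRing B]
    (χ : MulChar A B) : χ (-1) * χ (-1) = 1 := by
  rw [← map_mul, neg_one_mul, neg_neg, map_one]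

/-- The Gauss sum of a PRIMITIVE Dirichlet character modulo `N` against a primitive additive
character of `ℤ/N` is non-zero as soon as `N ≠ 0` in the target domain (e.g. characteristic `0`):
the «non-zero Gauss-sum factor» of the modified Euler factor at a ramified place above `p`. -/
theorem gaussSum_ne_zero_of_isPrimitive {χ : DirichletCharacter R N} (hχ : χ.IsPrimitive)
    {e : AddChar (ZMod N) R} (he : e.IsPrimitive) (hN : (N : R) ≠ 0) :
    gaussSum χ e ≠ 0 := by
  intro h
  have h1 := gaussSum_mul_gaussSum_inv_eq_of_isPrimitive hχ he
  rw [h, zero_mul] at h1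
  apply hN
  calc (N : R) = χ (-1) * χ (-1) * N := by rw [map_neg_one_mul_self', one_mul]
    _ = χ (-1) * (χ (-1) * N) := by rw [mul_assoc]
    _ = 0 := by rw [← h1, mul_zero]

/-- The same for the inverse character (the second factor of the product formula). -/
theorem gaussSum_inv_ne_zero_of_isPrimitive {χ : DirichletCharacter R N} (hχ : χ.IsPrimitive)
    {e : AddChar (ZMod N) R} (he : e.IsPrimitive) (hN : (N : R) ≠ 0) :
    gaussSum χ⁻¹ e ≠ 0 := by
  intro h
  have h1 := gaussSum_mul_gaussSum_inv_eq_of_isPrimitive hχ he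
  rw [h, mul_zero] at h1
  apply hN
  calc (N : R) = χ (-1) * χ (-1) * N := by rw [map_neg_one_mul_self', one_mul]
    _ = χ (-1) * (χ (-1) * N) := by rw [mul_assoc]
    _ = 0 := by rw [← h1, mul_zero]

end NonVanishing

end HodgeRepro.T3.GaussSumPair
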